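import Literature.MathematicalPhysics.QuantumFieldTheory.Balaban1983to89.T3UpperLiftSplit
import HarnessLib

/-!
# `Balaban1983to89.T3LowerActionSplit` — rung R3, crux K1, child «MinimiserStabilityRegPr» (stmt-QuantumFields-19200), stub LOWER: the
# located gap G-K1a-3b (`AvgActionIneqAt`: the d = 3 averaging action inequality `β_K A(D_{K,K+1}U′) ≤ β_{K+1}A(U′) + r_K` along print's
# run-`(K+1)` minimisers) SPLIT into [Balaban1985Variational] Thm 1 (9)–(10) (PRINTED, the sibling's gauge-invariant reading
# `MinimiserCurvGradAt`) ∧ a PER-CONFIGURATION action-defect statement about the (0.4) averaging and the Wilson action ALONE (located gap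
# G-K1a-3b′, `AvgActionDefectAt`), with the summability arithmetic PROVED — the LOWER twin of `T3UpperLiftSplit`

Cell `ym3-torus` (HUMAN RULING D-0037, YM ladder rung R3), seat `ym3-torus-p1` gen 7 (UV side); cell record HOME/UV3-NODE.md §16.  WHAT THIS IS
NOT: no action inequality is proved and nothing of Bałaban's is asserted — `AvgActionDefectAt` and `MinimiserCurvGradAt` are HYPOTHESIS
SCHEMAS; what is PROVED is the composition into `T3LowerAlongMinimisersSplit.AvgActionIneqAt` under the route's prefix (at EVERY radius
constant `B₃′ > 0` of the space (8) in which the minimiser is taken), and the resulting shape of the registered `stub_lower`.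

THE POINT.  `AvgActionIneqAt F γ b₀ p₀ m ε₀ B₃` asks for summable `r_K` with `β_K A(D_{K,K+1}U′) ≤ β_{K+1}A(U′) + r_K` for every
minimiser `U′` over print's space (6) of run `K+1` lying in (8) (radius `B₃θ`, `θ = θBal(⌊K/m⌋)`).  As for UPPER, the minimiser enters only
through its plaquette bound `a = B₃θL^{−2(k+1)}` ((8)) and its curvature-gradient bound `b = B₄θL^{−3(k+1)}` ((9)–(10)), `k = K − ⌊K/m⌋`:
* **`AvgActionDefectAt L C₂ c`** = located gap **G-K1a-3b′** (the d = 3 averaging action inequality for SMALL, SLOWLY VARYING FIELDS, per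
  configuration; printed IN KIND: [Federbush1987PhaseCellIII] Thm 4.3 (4.5) «coarse ≤ N^{4−d}·fine + f₂(Σ|A_{∂p}|²)^{3/2}» for Federbush's
  averaging): every `U` on the finest lattice of run `K+1` with plaquettes within `a` of `1` and curvature gradients `≤ b` (`0 ≤ a, b ≤ c`)
  satisfies `A(D_{K,K+1}U) ≤ L·A(U) + C₂(b² + ab + a³)·L^{3(m+K+1)}`.  WHY THE QUADRATIC PART IS EXACT (no `b` needed at leading order): in
  the linearised (0.4) average the coarse flux through `p′` is the MEAN over the `L³` block positions `y` of the fluxes `Φ_y` through the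
  `L × L` squares based at `y`; Jensen `(mean Φ)² ≤ mean Φ²`, Cauchy–Schwarz `Φ_y² ≤ L²·Σ_{p ⊂ sq_y} φ_p²`, and each fine plaquette lies in
  exactly `L²` such squares: `Σ_{p′} φ′² ≤ (L²·L²/L³)·Σ_p φ_p² = L·A_fine` — equality for constant flux, which is why the lift of
  `T3UpperLiftSplit` must carry exactly `1/L`; the corrections are cubic in the field (non-abelian) — the schema keeps the weaker form
  `C₂(b² + ab + a³)`, the same polynomial as UPPER's, so that ONE arithmetic serves both;
* **`avgActionIneqAt_of_split`** (PROVED): `MinimiserCurvGradAt L a₀ a₁ B₃ B₄ ∧ AvgActionDefectAt L C₂ c` ⇒ for EVERY `B₃′ > 0`: `∀ ε₀ ∈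
  (0, a₀], ∀ m ≥ 10, ∀ b₀ > 0, ∀ p₀, ∃ γ₁ > 0, ∀ F γ, F.L = L → 0 < γ ≤ γ₁ → AvgActionIneqAt F γ b₀ p₀ m ε₀ B₃′`, with `K₀ = 1` and
  `r_K = (C₂(B₄² + B₃′B₄ + B₃′³)L³·L^{3m}/γ)·(√(L⁻¹))^K` (`T3UpperLiftSplit.defect_le` at `k + 1`, `L^{−5(k+1)} ≤ L^{−5k}`, `L^{3(m+K+1)} =
  L³L^{3(m+K)}`, `T3UpperLiftSplit.beta_mul_defect_le`); `γ₁` puts `θ ≤ min {1, a₁, ε₀/B₃, ε₀/B₃′, c/B₃′, c/B₄}` at every height;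
* **`stub_lower_shape_of_split'`**: the BODY of the registered `stub_lower` (layer-4 birth v2, skeleton bae94eb2c92e16a5, for one `L ≥ 1`) from
  `MinimisersIn8At` ([7] Prop 8, PRINTED) ∧ `MinimiserCurvGradAt` ([7] Thm 1 (9)–(10), PRINTED) ∧ `AvgCurvGradAt` (G-K1a-3a′) ∧
  `AvgActionDefectAt` (G-K1a-3b′) — via the sibling's `T3AvgDivergenceSplit.stub_lower_shape_of_split` at `B₃′ = max B₃ (4C₁B₄/L³)`.
So LOWER, like UPPER, = two PRINTED schemas + located statements of pure lattice geometry about the (0.4) averaging (first-order regularity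
G-K1a-3a′, action defect G-K1a-3b′); no schema about minimisers remains outside print.

References: T. Bałaban, CMP 102 (1985) 277–309 [Balaban1985Variational] (Thm 1 (8)–(10) p.279, Prop 8 p.304); CMP 102 (1985) 255–275
[Balaban1985UV3] ((3)/(5) p.256: `β_{K+1} = Lβ_K`); CMP 109 (1987) 249–301 [Balaban1987RG1] ((0.4), p.253); P. Federbush, CMP 110 (1987) 293–309
[Federbush1987PhaseCellIII] (Thm 4.3 (4.5) p.299).
-/

noncomputable section

open MeasureTheory Filter Topology
open scoped Matrix.Norms.L2Operator
open Literature.MathematicalPhysics.QuantumFieldTheory.Balaban1983to89.T3ContinuumYM3Torus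
open Literature.MathematicalPhysics.QuantumFieldTheory.Balaban1983to89.T3UnitLawDensityEML (ℰp measurableE_ℰp)
open Literature.MathematicalPhysics.QuantumFieldTheory.Balaban1983to89.T3UnitScaleTilt
open Literature.MathematicalPhysics.QuantumFieldTheory.Balaban1983to89.T3TiltDescent
open Literature.MathematicalPhysics.QuantumFieldTheory.Balaban1983to89.T3CruxEstimates
open Literature.MathematicalPhysics.QuantumFieldTheory.Balaban1983to89.T3ConstrainedMinimiser
open Literature.MathematicalPhysics.QuantumFieldTheory.Balaban1983to89.T3DescentFibreTower
open Literature.MathematicalPhysics.QuantumFieldTheory.Balaban1983to89.T3MinimiserStabilityReduction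
open Literature.MathematicalPhysics.QuantumFieldTheory.Balaban1983to89.T3RegularMinimiser
open Literature.MathematicalPhysics.QuantumFieldTheory.Balaban1983to89.T3PrintedRegularMinimiser
open Literature.MathematicalPhysics.QuantumFieldTheory.Balaban1983to89.T3PrintedRegularMinimiserReduction
open Literature.MathematicalPhysics.QuantumFieldTheory.Balaban1983to89.T3PrintedMinimiserExistence
open Literature.MathematicalPhysics.QuantumFieldTheory.Balaban1983to89.T3ThresholdSmallness (exists_forall_θBal_le)
open Literature.MathematicalPhysics.QuantumFieldTheory.Balaban1983to89.T3LowerAlongMinimisersSplit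
open Literature.MathematicalPhysics.QuantumFieldTheory.Balaban1983to89.T3AvgDivergenceSplit
open Literature.MathematicalPhysics.QuantumFieldTheory.Balaban1983to89.T3UpperLiftSplit
open Literature.MathematicalPhysics.QuantumFieldTheory.Balaban1983to89.B10Eq27TorusAxialLog (toUField unitsField)
open Literature.MathematicalPhysics.QuantumFieldTheory.Balaban1983to89.B10Eq68TorusRegularity (plaqFT covDerivT covDivT)
open Literature.MathematicalPhysics.QuantumFieldTheory.Balaban1983to89.Missing

namespace Literature.MathematicalPhysics.QuantumFieldTheory.Balaban1983to89.T3LowerActionSplit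

/-! ## §1 The located schema G-K1a-3b′: per-configuration averaging action defect -/

section Schema

/-- **LOCATED GAP G-K1a-3b′ AS A SCHEMA — THE d = 3 AVERAGING ACTION INEQUALITY FOR SMALL, SLOWLY VARYING FIELDS, PER CONFIGURATION**
(hypothesis, never asserted; NOT PRINTED for the (0.4) averaging and the Wilson action): for every configuration `U` on the finest lattice
of the `(K+1)`-th approximation whose plaquette variables are within `a` of `1` and whose plaquette fields have all backward covariant
derivatives `≤ b` (`0 ≤ a, b ≤ c`), the Wilson action of its one-step (0.4)-average satisfies `A(D_{K,K+1}U) ≤ L·A(U) + C₂(b² + ab +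
a³)·L^{3(m+K+1)}` — coarse action at most `L = L^{4−d}` times fine action (exact at quadratic order by Jensen and Cauchy–Schwarz over the
`L²` translated squares) up to a defect cubic in the field and quadratic in the gradient over the `24L^{3(m+K+1)}` plaquettes.  Printed in
kind for Federbush's averaging and modified action. [cite: Federbush1987PhaseCellIII, Thm 4.3 (4.5) p.299] -/
def AvgActionDefectAt (L : ℕ) (C₂ c : ℝ) : Prop :=
  ∀ F : T3Family, F.L = L → ∀ (K : ℕ) (a b : ℝ), 0 ≤ a → a ≤ c → 0 ≤ b → b ≤ c →
    ∀ U : GaugeField (F.P (K + 1)) 0 (Matrix.specialUnitaryGroup (Fin 2) ℂ), PlaqSmall a U →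
      (∀ (x : Site (F.P (K + 1)) 0) (ν κ κ' : Fin (F.P (K + 1)).d), κ ≠ κ' →
        ‖covDerivT 1 (unitsField (toUField U)) ν (plaqFT (unitsField (toUField U)) κ κ') x‖ ≤ b) →
        wilsonAction4 (descendTo F ℰp K (K + 1) (Nat.le_succ K) U) ≤
          (F.L : ℝ) * wilsonAction4 U + C₂ * (b ^ 2 + a * b + a ^ 3) * (F.L : ℝ) ^ (3 * (F.m + (K + 1)))

end Schema

/-! ## §2 The composition: G-K1a-3b ⇐ Thm 1 (9)–(10) ∧ G-K1a-3b′ at every radius constant, PROVED under the route's prefix -/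

section Split

/-- **G-K1a-3b ⇐ [Balaban1985Variational] THM 1 (9)–(10) ∧ G-K1a-3b′** (PROVED), at EVERY radius constant `B₃′ > 0` of the space (8) in which
the run-`(K+1)` minimiser is taken: given `MinimiserCurvGradAt L a₀ a₁ B₃ B₄` and `AvgActionDefectAt L C₂ c` (`a₀, a₁, B₃, B₄, B₃′, c > 0`,
`C₂ ≥ 0`), for every `0 < ε₀ ≤ a₀`, `m ≥ 10`, `b₀ > 0`, real `p₀` there is `γ₁ > 0` such that `AvgActionIneqAt F γ b₀ p₀ m ε₀ B₃′` holds for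
all `F` with `F.L = L` and `0 < γ ≤ γ₁`, with `K₀ = 1` and `r_K = (C₂(B₄² + B₃′B₄ + B₃′³)L³L^{3m_F}/γ)·(√(L⁻¹))^K`.
[cite: Balaban1985Variational, Thm 1 (8)-(10) p.279; Federbush1987PhaseCellIII, Thm 4.3 (4.5) p.299] -/
theorem avgActionIneqAt_of_split {L : ℕ} {a₀ a₁ B₃ B₄ C₂ c B₃' : ℝ} (ha₁ : 0 < a₁) (hB₃ : 0 < B₃) (hB₄ : 0 < B₄) (hC₂ : 0 ≤ C₂)
    (hc : 0 < c) (hB₃' : 0 < B₃') (hgrad : MinimiserCurvGradAt L a₀ a₁ B₃ B₄) (hdef : AvgActionDefectAt L C₂ c) :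
    ∀ ε₀ : ℝ, 0 < ε₀ → ε₀ ≤ a₀ → ∀ m : ℕ, 10 ≤ m → ∀ b₀ p₀ : ℝ, 0 < b₀ →
      ∃ γ₁ : ℝ, 0 < γ₁ ∧ ∀ (F : T3Family) (γ : ℝ), F.L = L → 0 < γ → γ ≤ γ₁ → AvgActionIneqAt F γ b₀ p₀ m ε₀ B₃' := by
  intro ε₀ hε₀ hε₀a m hm b₀ p₀ hb
  by_cases hL : 1 ≤ L
  · -- thresholds at every height
    set σ : ℝ := min 1 (min a₁ (min (ε₀ / B₃) (min (ε₀ / B₃') (min (c / B₃') (c / B₄))))) with hσ_def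
    have hσ : 0 < σ := lt_min one_pos (lt_min ha₁ (lt_min (by positivity) (lt_min (by positivity) (lt_min (by positivity) (by positivity)))))
    obtain ⟨γ₁, hγ₁, hθ⟩ := exists_forall_θBal_le hL b₀ p₀ hσ
    refine ⟨min γ₁ 1, lt_min hγ₁ one_pos, fun F γ hF hγ hγle => ?_⟩
    subst hF
    have hγ₁' : γ ≤ γ₁ := hγle.trans (min_le_left _ _)
    have hγ1 : γ ≤ 1 := hγle.trans (min_le_right _ _)
    have hFL : 1 ≤ F.L := F.hL.2.le
    have hLF : (0 : ℝ) < F.L := L_cast_pos F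
    -- the radii
    set M : ℝ := C₂ * (B₄ ^ 2 + B₃' * B₄ + B₃' ^ 3) * (F.L : ℝ) ^ 3 with hM_def
    have hM : 0 ≤ M := by positivity
    refine ⟨1, fun K => (M * (F.L : ℝ) ^ (3 * F.m) / γ) * (Real.sqrt ((F.L : ℝ)⁻¹)) ^ K, ?_, fun K => by positivity,
      fun K hK V hV U' hU8 hmin => ?_⟩
    · have hs : Real.sqrt ((F.L : ℝ)⁻¹) < 1 :=
        (Real.sqrt_lt_sqrt (inv_pos.mpr hLF).le (inv_lt_one_of_one_lt₀ (by exact_mod_cast F.hL.2))).trans_eq Real.sqrt_one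
      exact (summable_geometric_of_lt_one (Real.sqrt_nonneg _) hs).mul_left _
    have hnK : K / m < K := Nat.div_lt_self (by omega) (by omega)
    have hnK' : K / m < K + 1 := hnK.trans (Nat.lt_succ_self K)
    -- `θ := θBal(⌊K/m⌋)` and its smallness conditions
    set θ := θBal F.L γ b₀ p₀ (K / m) with hθ_def
    have hθ0 : 0 < θ := θBal_pos hFL hγ hγ1 hb p₀ (K / m)
    have hθσ : θ ≤ σ := hθ γ hγ hγ₁' (K / m)
    have hθ1 : θ ≤ 1 := hθσ.trans (min_le_left _ _)
    have hθa₁ : θ ≤ a₁ := hθσ.trans ((min_le_right _ _).trans (min_le_left _ _))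
    have hθ3 : θ ≤ ε₀ / B₃ := hθσ.trans ((min_le_right _ _).trans ((min_le_right _ _).trans (min_le_left _ _)))
    have hθ4 : θ ≤ ε₀ / B₃' :=
      hθσ.trans ((min_le_right _ _).trans ((min_le_right _ _).trans ((min_le_right _ _).trans (min_le_left _ _))))
    have hθ5 : θ ≤ c / B₃' :=
      hθσ.trans ((min_le_right _ _).trans ((min_le_right _ _).trans ((min_le_right _ _).trans ((min_le_right _ _).trans
        (min_le_left _ _)))))
    have hθ6 : θ ≤ c / B₄ :=
      hθσ.trans ((min_le_right _ _).trans ((min_le_right _ _).trans ((min_le_right _ _).trans ((min_le_right _ _).trans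
        (min_le_right _ _)))))
    have hlo : B₃ * θ ≤ ε₀ := by
      have h := mul_le_mul_of_nonneg_left hθ3 hB₃.le
      rwa [mul_div_cancel₀ _ hB₃.ne'] at h
    have hlo' : B₃' * θ ≤ ε₀ := by
      have h := mul_le_mul_of_nonneg_left hθ4 hB₃'.le
      rwa [mul_div_cancel₀ _ hB₃'.ne'] at h
    have hBc : B₃' * θ ≤ c := by
      have h := mul_le_mul_of_nonneg_left hθ5 hB₃'.le
      rwa [mul_div_cancel₀ _ hB₃'.ne'] at h
    have hB4c : B₄ * θ ≤ c := by
      have h := mul_le_mul_of_nonneg_left hθ6 hB₄.le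
      rwa [mul_div_cancel₀ _ hB₄.ne'] at h
    -- the two numbers the minimiser contributes at run `K+1`: `a = B₃′θx^{2(k+1)}`, `b = B₄θx^{3(k+1)}`
    set x : ℝ := (F.L : ℝ)⁻¹ with hx_def
    have hx : 0 < x := inv_pos.mpr hLF
    have hx1 : x ≤ 1 := inv_le_one_of_one_le₀ (by exact_mod_cast hFL)
    set a : ℝ := regThreshold F (K / m) (K + 1) (B₃' * θ) with ha_def
    have ha_eq : a = B₃' * θ * x ^ (2 * (K + 1 - K / m)) := rfl
    set b : ℝ := B₄ * θ * x ^ (3 * (K + 1 - K / m)) with hb_def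
    have ha0 : 0 ≤ a := by rw [ha_eq]; positivity
    have hac : a ≤ c := by rw [ha_eq]; exact (mul_le_of_le_one_right (by positivity) (pow_le_one₀ hx.le hx1)).trans hBc
    have hb0 : 0 ≤ b := by positivity
    have hbc : b ≤ c := (mul_le_of_le_one_right (by positivity) (pow_le_one₀ hx.le hx1)).trans hB4c
    -- (9)–(10) for the run-`(K+1)` minimiser, which lies in (6)(ε₀) ⊇ (8)(B₃′θ)
    have hU6 : U' ∈ regFibrePr F (K / m) (K + 1) ((Nat.div_le_self K m).trans (Nat.le_succ K)) ε₀ V := regFibrePr_mono F hlo' V hU8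
    have hder : ∀ (y : Site (F.P (K + 1)) 0) (ν κ κ' : Fin (F.P (K + 1)).d), κ ≠ κ' →
        ‖covDerivT 1 (unitsField (toUField U')) ν (plaqFT (unitsField (toUField U')) κ κ') y‖ ≤ b :=
      fun y ν κ κ' hne => (hgrad F rfl (K / m) (K + 1) hnK' θ ε₀ hθ0 hθa₁ hlo hε₀a V hV U' hU6 hmin y ν κ κ' hne).le
    -- the per-configuration defect
    have hact := hdef F rfl K a b ha0 hac hb0 hbc U' hU8.1.2 hder
    -- `β_K A(DU′) ≤ β_K (L A(U′) + defect) = β_{K+1}A(U′) + β_K·defect ≤ β_{K+1}A(U′) + r_K`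
    have hβ : 0 ≤ (F.scheme ℰp γ).β K := by
      rw [scheme_β_eq]; exact (inv_pos.mpr (mul_pos hγ (pow_pos hx K))).le
    have hdef' : C₂ * (b ^ 2 + a * b + a ^ 3) ≤ C₂ * (B₄ ^ 2 + B₃' * B₄ + B₃' ^ 3) * θ ^ 2 * x ^ (5 * (K + 1 - K / m)) :=
      defect_le F (B₄ := B₄) hB₃'.le hC₂ hθ1 (K + 1 - K / m)
    have hx5 : x ^ (5 * (K + 1 - K / m)) ≤ x ^ (5 * (K - K / m)) := pow_le_pow_of_le_one hx.le hx1 (by omega)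
    have hdefect : C₂ * (b ^ 2 + a * b + a ^ 3) * (F.L : ℝ) ^ (3 * (F.m + (K + 1))) ≤
        M * θ ^ 2 * x ^ (5 * (K - K / m)) * (F.L : ℝ) ^ (3 * (F.m + K)) := by
      have h1 : C₂ * (b ^ 2 + a * b + a ^ 3) ≤ C₂ * (B₄ ^ 2 + B₃' * B₄ + B₃' ^ 3) * θ ^ 2 * x ^ (5 * (K - K / m)) :=
        hdef'.trans (mul_le_mul_of_nonneg_left hx5 (by positivity))
      rw [show (F.L : ℝ) ^ (3 * (F.m + (K + 1))) = (F.L : ℝ) ^ 3 * (F.L : ℝ) ^ (3 * (F.m + K)) by rw [← pow_add]; congr 1; ring,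
        show M * θ ^ 2 * x ^ (5 * (K - K / m)) * (F.L : ℝ) ^ (3 * (F.m + K)) =
          (C₂ * (B₄ ^ 2 + B₃' * B₄ + B₃' ^ 3) * θ ^ 2 * x ^ (5 * (K - K / m))) * ((F.L : ℝ) ^ 3 * (F.L : ℝ) ^ (3 * (F.m + K))) by
          rw [hM_def]; ring]
      exact mul_le_mul_of_nonneg_right h1 (by positivity)
    calc (F.scheme ℰp γ).β K * wilsonAction4 (descendTo F ℰp K (K + 1) (Nat.le_succ K) U')
        ≤ (F.scheme ℰp γ).β K * ((F.L : ℝ) * wilsonAction4 U' + C₂ * (b ^ 2 + a * b + a ^ 3) * (F.L : ℝ) ^ (3 * (F.m + (K + 1)))) :=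
          mul_le_mul_of_nonneg_left hact hβ
      _ = (F.scheme ℰp γ).β (K + 1) * wilsonAction4 U' +
            (F.scheme ℰp γ).β K * (C₂ * (b ^ 2 + a * b + a ^ 3) * (F.L : ℝ) ^ (3 * (F.m + (K + 1)))) := by
          rw [scheme_β_succ]; ring
      _ ≤ (F.scheme ℰp γ).β (K + 1) * wilsonAction4 U' +
            (F.scheme ℰp γ).β K * (M * θ ^ 2 * x ^ (5 * (K - K / m)) * (F.L : ℝ) ^ (3 * (F.m + K))) :=
          add_le_add le_rfl (mul_le_mul_of_nonneg_left hdefect hβ)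
      _ ≤ (F.scheme ℰp γ).β (K + 1) * wilsonAction4 U' + (M * (F.L : ℝ) ^ (3 * F.m) / γ) * (Real.sqrt ((F.L : ℝ)⁻¹)) ^ K :=
          add_le_add le_rfl (beta_mul_defect_le F hm hγ hM hθ0.le hθ1 K)
  · refine ⟨1, one_pos, fun F γ hF _ _ => ?_⟩
    exact absurd (hF ▸ F.hL.2.le) hL

end Split

/-! ## §3 What the registered `stub_lower` of the layer-4 birth now rests on; LOWER itself -/

section StubLower

/-- **THE BODY OF THE REGISTERED `stub_lower` (layer-4 birth v2 of stmt-QuantumFields-19200, for one `L ≥ 1`) FROM PRINT + G-K1a-3a′ + G-K1a-3b′**: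
`MinimisersIn8At` ([Balaban1985Variational] Prop 8, PRINTED) ∧ `MinimiserCurvGradAt` (Thm 1 (9)–(10), PRINTED) ∧ `AvgCurvGradAt` (located
G-K1a-3a′: first-order regularity of the one-step average) ∧ `AvgActionDefectAt` (located G-K1a-3b′: per-configuration averaging action
defect) ⇒ `∃ a₀ a₁ B₃ > 0, MinimisersIn8At ∧ AvgDivSmallAt ∧ (prefix) AvgActionIneqAt` verbatim as registered (at `B₃′ = max B₃ (4C₁B₄/L³)`,
`m₀ = 10`). [cite: Balaban1985Variational, Thm 1 (8)-(10) p.279 and Prop 8 p.304; Federbush1987PhaseCellIII, Thm 4.3 (4.5) p.299] -/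
theorem stub_lower_shape_of_split' {L : ℕ} (hL : 1 ≤ L) {a₀ a₁ B₃ B₄ C₁ C₂ c C₂' c' : ℝ} (ha₀ : 0 < a₀) (ha₁ : 0 < a₁) (hB₃ : 0 < B₃)
    (hB₄ : 0 < B₄) (hC₂ : 0 < C₂) (hc : 0 < c) (hC₂' : 0 ≤ C₂') (hc' : 0 < c') (h8 : MinimisersIn8At L a₀ a₁ B₃)
    (hgrad : MinimiserCurvGradAt L a₀ a₁ B₃ B₄) (havg : AvgCurvGradAt L C₁ C₂ c) (hdef : AvgActionDefectAt L C₂' c') :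
    ∃ a₀ a₁ B₃ : ℝ, 0 < a₀ ∧ 0 < a₁ ∧ 0 < B₃ ∧
      MinimisersIn8At L a₀ a₁ B₃ ∧ AvgDivSmallAt L a₀ a₁ B₃ ∧
      ∃ ε₁ : ℝ, 0 < ε₁ ∧ ∀ (ε₀ : ℝ), 0 < ε₀ → ε₀ ≤ ε₁ → ∃ m₀ : ℕ, ∀ (m : ℕ), m₀ ≤ m → ∀ (b₀ p₀ : ℝ), 0 < b₀ → 2 < p₀ →
        ∃ γ₁ : ℝ, 0 < γ₁ ∧ ∀ (F : T3Family) (γ : ℝ), F.L = L → 0 < γ → γ ≤ γ₁ →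
          AvgActionIneqAt F γ b₀ p₀ m ε₀ B₃ := by
  have hL0 : (0 : ℝ) < (L : ℝ) := by exact_mod_cast hL
  have hB₃' : 0 < max B₃ (4 * (C₁ * B₄) / (L : ℝ) ^ 3) := hB₃.trans_le (le_max_left _ _)
  have H := avgActionIneqAt_of_split ha₁ hB₃ hB₄ hC₂' hc' hB₃' hgrad hdef
  refine stub_lower_shape_of_split hL ha₀ ha₁ hB₃ hB₄.le hC₂ hc h8 hgrad havg ⟨a₀, ha₀, fun ε₀ hε₀ hε₀le => ⟨10, ?_⟩⟩
  intro m hm b₀ p₀ hb _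
  exact H ε₀ hε₀ hε₀le m hm b₀ p₀ hb

/-- **LOWER itself from the same pieces** (`LowerAlongRegPrMinimisersAt`, through the siblings' `lowerAlongRegPrMinimisersAt_of_split''`):
for small `ε₀`, `m ≥ 10`, `b₀ > 0`, real `p₀`, small `γ`. [cite: Balaban1985Variational, Thm 1 (8)-(10) p.279 and Prop 8 p.304] -/
theorem lowerAlongRegPrMinimisersAt_of_split''' {L : ℕ} (hL : 1 ≤ L) {a₀ a₁ B₃ B₄ C₁ C₂ c C₂' c' : ℝ} (ha₀ : 0 < a₀) (ha₁ : 0 < a₁)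
    (hB₃ : 0 < B₃) (hB₄ : 0 < B₄) (hC₂ : 0 < C₂) (hc : 0 < c) (hC₂' : 0 ≤ C₂') (hc' : 0 < c')
    (h8 : MinimisersIn8At L a₀ a₁ B₃) (hgrad : MinimiserCurvGradAt L a₀ a₁ B₃ B₄) (havg : AvgCurvGradAt L C₁ C₂ c)
    (hdef : AvgActionDefectAt L C₂' c') :
    ∃ ε₁' : ℝ, 0 < ε₁' ∧ ∀ ε₀ : ℝ, 0 < ε₀ → ε₀ ≤ ε₁' → ∀ m : ℕ, 10 ≤ m → ∀ b₀ p₀ : ℝ, 0 < b₀ →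
      ∃ γ₁ : ℝ, 0 < γ₁ ∧ ∀ (F : T3Family) (γ : ℝ), F.L = L → 0 < γ → γ ≤ γ₁ →
        LowerAlongRegPrMinimisersAt F γ b₀ p₀ m ε₀ := by
  have hL0 : (0 : ℝ) < (L : ℝ) := by exact_mod_cast hL
  have hB₃' : 0 < max B₃ (4 * (C₁ * B₄) / (L : ℝ) ^ 3) := hB₃.trans_le (le_max_left _ _)
  obtain ⟨e₁, he₁, H₁⟩ := lowerAlongRegPrMinimisersAt_of_split'' hL ha₀ ha₁ hB₃ hB₄.le hC₂ hc h8 hgrad havg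
  have H₂ := avgActionIneqAt_of_split ha₁ hB₃ hB₄ hC₂' hc' hB₃' hgrad hdef
  refine ⟨min e₁ a₀, lt_min he₁ ha₀, fun ε₀ hε₀ hle m hm b₀ p₀ hb => ?_⟩
  obtain ⟨γa, hγa, hA⟩ := H₁ ε₀ hε₀ (hle.trans (min_le_left _ _)) m (le_trans (by norm_num) hm) b₀ p₀ hb
  obtain ⟨γb, hγb, hB⟩ := H₂ ε₀ hε₀ (hle.trans (min_le_right _ _)) m hm b₀ p₀ hb
  refine ⟨min γa γb, lt_min hγa hγb, fun F γ hF hγ hγle => ?_⟩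
  exact hA F γ hF hγ (hγle.trans (min_le_left _ _)) (hB F γ hF hγ (hγle.trans (min_le_right _ _)))

end StubLower

end Literature.MathematicalPhysics.QuantumFieldTheory.Balaban1983to89.T3LowerActionSplit

end
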